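import Mathlib
import HarnessLib
import Summits.QuantumFields.YangMills.Theorems.U1DipoleHelicityWardReal
import Summits.QuantumFields.YangMills.Theorems.U1DipoleHelicityTorusGreenLaplacian
import Summits.QuantumFields.YangMills.Theorems.U1DipoleHelicitySecondMomentLower
import Summits.QuantumFields.YangMills.Theorems.U1DipoleHelicityTorusSBP

/-!
# The optimal Bogoliubov test form: `2β⟨sin²θ_p⟩_μ ≥ 1 − ε` for every weak-coupling limit state of
# Wilson `U(1)₄` (parity-free lower half of the plaquette second moment)

Route-independent (no `Theses` import) completion of the lower half of the crux stmt-QuantumFields-25881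
`Theses.U1DipoleHelicity.WilsonU1PlaquetteSecondMomentD4` of the abelian comparison line `U1DipoleHelicity`
(LINE 4 of the ideator cell ym-idea-2; not a rung of `YangMills`).

The lattice Bogoliubov inequality (`U1DipoleHelicityWardReal.sq_rplaqCharge_mul_le_sum_sq`: on every torus
`n_p² m ≤ β⟨sin²θ_p⟩ · Σ_q n_q²` for every real test 1-form `c`, `n = dc`, `m = ⟨cos θ_p⟩`) is evaluated on
the test form `ψ = d*(G̃ ⊗ e₀∧e₁)` built from the zero-mode-free torus Green function `G̃ = torusGreen`
(`testForm`): `ψ(y,0) = G̃(y) − G̃(y−e₁)`, `ψ(y,1) = G̃(y−e₀) − G̃(y)`, `ψ(y,2) = ψ(y,3) = 0`.  Its charges are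
`n_{(y;0,1)} = (−Δ₀−Δ₁)G̃(y)`, `n_{(y;0,k)} = −∇ₖ∇₁⁻G̃`, `n_{(y;1,k)} = ∇ₖ∇₀⁻G̃` (`k = 2,3`), `n_{(y;2,3)} = 0`
(`rplaqCharge_testForm_*`); summation by parts on the torus (`U1DipoleHelicityTorusSBP`:
`sum_sq_backDiff_sub_shift`) gives
`Σ_q n_q² = Σ_y (−Δ₀−Δ₁)G̃(y) · (−ΔG̃)(y)`, and the Poisson equation `−ΔG̃ = 2(δ₀ − L⁻⁴)`
(`sum_secondDiff_torusGreen`) with translation invariance yields **`Σ_q n_q² = 2 n_p`**, while isotropy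
(`secondDiff_torusGreen_zero`) yields **`n_p = 1 − L⁻⁴`** (`= 2·P(p,p)`, `P` the projection onto exact
2-forms).  Hence on every torus of side `L ≥ 2` and every `β ≥ 0`:
`(1 − L⁻⁴)·⟨cos θ_p⟩ ≤ 2β⟨sin²θ_p⟩` (`torusPlaqSinSq_ge_optimal`), and with the tree's one-point theorem
(`⟨cos θ_p⟩ → 1`) and the limit along the defining tori:
`wilsonU1PlaquetteSecondMoment_lower : ∀ ε>0 ∃ β₁ ∀ β>β₁ ∀ μ ∈ limit points, 1 − ε ≤ 2β·plaqCorr μ 0 0 1`.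

Nothing here bears on the Yang–Mills mass gap.
-/

noncomputable section

namespace Summit.QuantumFields.YangMills.Theorems.U1DipoleHelicity

open MeasureTheory Filter Topology Finset
open Literature.Probability.LatticeModels Literature.MathematicalPhysics.QuantumLattice
open Literature.MathematicalPhysics.QuantumFieldTheory
open Summit.QuantumFields.YangMills.Theorems.U1Helicity



/-! ### The test form and its plaquette charges -/

variable {L : ℕ} [NeZero L]

/-- **The optimal test 1-form** `ψ = d*(g ⊗ e₀∧e₁)` of a function `g` on the four-torus:
`ψ(y,0) = g(y) − g(y − e₁)`, `ψ(y,1) = g(y − e₀) − g(y)`, `ψ(y,2) = ψ(y,3) = 0`. [folklore] -/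
def testForm (g : Site 4 L → ℝ) (e : Edge 4 L) : ℝ :=
  if e.2 = 0 then g e.1 - g (e.1 - Pi.single 1 1)
  else if e.2 = 1 then g (e.1 - Pi.single 0 1) - g e.1 else 0

omit [NeZero L] in
/-- Values of the test form. [folklore] -/
theorem testForm_zero (g : Site 4 L → ℝ) (y : Site 4 L) :
    testForm g (y, 0) = g y - g (y - Pi.single 1 1) := by simp [testForm]

omit [NeZero L] in
/-- Values of the test form. [folklore] -/
theorem testForm_one (g : Site 4 L → ℝ) (y : Site 4 L) :
    testForm g (y, 1) = g (y - Pi.single 0 1) - g y := by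
  simp [testForm, show (1 : Fin 4) ≠ 0 by decide]

omit [NeZero L] in
/-- Values of the test form. [folklore] -/
theorem testForm_of_two_le (g : Site 4 L → ℝ) (y : Site 4 L) {k : Fin 4} (h0 : k ≠ 0) (h1 : k ≠ 1) :
    testForm g (y, k) = 0 := by simp [testForm, h0, h1]

omit [NeZero L] in
/-- The charge of the test form on the `(0,1)` plaquettes: `(−Δ₀ − Δ₁) g`. [folklore] -/
theorem rplaqCharge_testForm_zero_one (g : Site 4 L → ℝ) (y : Site 4 L) :
    rplaqCharge (testForm g) y 0 1 =
      (2 * g y - g (y + Pi.single 0 1) - g (y - Pi.single 0 1)) +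
        (2 * g y - g (y + Pi.single 1 1) - g (y - Pi.single 1 1)) := by
  simp only [rplaqCharge, Literature.MathematicalPhysics.QuantumFieldTheory.Site.shift, testForm_zero,
    testForm_one, add_sub_cancel_right]
  ring

omit [NeZero L] in
/-- The charge of the test form on the `(0,k)` plaquettes, `k ≥ 2`: `−∇ₖ∇₁⁻ g`. [folklore] -/
theorem rplaqCharge_testForm_zero_of_two_le (g : Site 4 L → ℝ) (y : Site 4 L) {k : Fin 4} (h0 : k ≠ 0)
    (h1 : k ≠ 1) :
    rplaqCharge (testForm g) y 0 k =
      (g y - g (y - Pi.single 1 1)) - (g (y + Pi.single k 1) - g (y + Pi.single k 1 - Pi.single 1 1)) := by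
  simp only [rplaqCharge, Literature.MathematicalPhysics.QuantumFieldTheory.Site.shift, testForm_zero,
    testForm_of_two_le g _ h0 h1]
  ring

omit [NeZero L] in
/-- The charge of the test form on the `(1,k)` plaquettes, `k ≥ 2`: `∇ₖ∇₀⁻ g`. [folklore] -/
theorem rplaqCharge_testForm_one_of_two_le (g : Site 4 L → ℝ) (y : Site 4 L) {k : Fin 4} (h0 : k ≠ 0)
    (h1 : k ≠ 1) :
    rplaqCharge (testForm g) y 1 k =
      (g (y - Pi.single 0 1) - g y) - (g (y + Pi.single k 1 - Pi.single 0 1) - g (y + Pi.single k 1)) := by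
  simp only [rplaqCharge, Literature.MathematicalPhysics.QuantumFieldTheory.Site.shift, testForm_one,
    testForm_of_two_le g _ h0 h1]
  ring

omit [NeZero L] in
/-- The charge of the test form on the `(2,3)` plaquettes vanishes. [folklore] -/
theorem rplaqCharge_testForm_two_three (g : Site 4 L → ℝ) (y : Site 4 L) :
    rplaqCharge (testForm g) y 2 3 = 0 := by
  simp only [rplaqCharge, Literature.MathematicalPhysics.QuantumFieldTheory.Site.shift,
    testForm_of_two_le g _ (show (2 : Fin 4) ≠ 0 by decide)
    (show (2 : Fin 4) ≠ 1 by decide), testForm_of_two_le g _ (show (3 : Fin 4) ≠ 0 by decide)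
    (show (3 : Fin 4) ≠ 1 by decide)]
  ring

/-- Splitting a sum over the six coordinate planes of `ℤ⁴`. [folklore] -/
theorem sum_planes (F : Fin 4 → Fin 4 → ℝ) :
    ∑ kl : {p : Fin 4 × Fin 4 // p.1 < p.2}, F kl.1.1 kl.1.2 =
      F 0 1 + F 0 2 + F 0 3 + F 1 2 + F 1 3 + F 2 3 := by
  rw [← Finset.sum_subtype (Finset.univ.filter fun p : Fin 4 × Fin 4 => p.1 < p.2)
    (fun p => by simp) (fun p : Fin 4 × Fin 4 => F p.1 p.2)]
  rw [Finset.sum_filter, Fintype.sum_prod_type]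
  simp [Fin.sum_univ_four]
  ring

/-- **The norm of the charges of the test form**: for every `g` on the four-torus,
`Σ_q (dψ)_q² = Σ_y (−Δ₀−Δ₁)g(y) · (−Δ)g(y)`. [folklore] -/
theorem sum_sq_rplaqCharge_testForm (g : Site 4 L → ℝ) :
    ∑ q : Plaquette 4 L, rplaqCharge (testForm g) q.1 q.2.1.1 q.2.1.2 ^ 2 =
      ∑ y : Site 4 L,
        ((2 * g y - g (y + Pi.single 0 1) - g (y - Pi.single 0 1)) +
            (2 * g y - g (y + Pi.single 1 1) - g (y - Pi.single 1 1))) *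
          ∑ μ : Fin 4, (2 * g y - g (y + Pi.single μ 1) - g (y - Pi.single μ 1)) := by
  rw [Fintype.sum_prod_type]
  rw [Finset.sum_congr rfl fun (y : Site 4 L) _ =>
    sum_planes (fun k l => rplaqCharge (testForm g) y k l ^ 2)]
  simp_rw [rplaqCharge_testForm_zero_one, rplaqCharge_testForm_two_three,
    rplaqCharge_testForm_zero_of_two_le g _ (show (2 : Fin 4) ≠ 0 by decide) (show (2 : Fin 4) ≠ 1 by decide),
    rplaqCharge_testForm_zero_of_two_le g _ (show (3 : Fin 4) ≠ 0 by decide) (show (3 : Fin 4) ≠ 1 by decide),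
    rplaqCharge_testForm_one_of_two_le g _ (show (2 : Fin 4) ≠ 0 by decide) (show (2 : Fin 4) ≠ 1 by decide),
    rplaqCharge_testForm_one_of_two_le g _ (show (3 : Fin 4) ≠ 0 by decide) (show (3 : Fin 4) ≠ 1 by decide)]
  simp only [Finset.sum_add_distrib, Fin.sum_univ_four]
  -- the four mixed-plane sums by parts
  have m02 := sum_sq_backDiff_sub_shift g (Pi.single 1 1) (Pi.single (2 : Fin 4) (1 : ZMod L))
  have m03 := sum_sq_backDiff_sub_shift g (Pi.single 1 1) (Pi.single (3 : Fin 4) (1 : ZMod L))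
  have m12 := sum_sq_backDiff_sub_shift g (Pi.single 0 1) (Pi.single (2 : Fin 4) (1 : ZMod L))
  have m13 := sum_sq_backDiff_sub_shift g (Pi.single 0 1) (Pi.single (3 : Fin 4) (1 : ZMod L))
  have e12 : ∀ k : Fin 4, ∑ y : Site 4 L,
      ((g (y - Pi.single 0 1) - g y) - (g (y + Pi.single k 1 - Pi.single 0 1) - g (y + Pi.single k 1))) ^ 2 =
      ∑ y : Site 4 L, ((g y - g (y - Pi.single 0 1)) - (g (y + Pi.single k 1) - g (y + Pi.single k 1 - Pi.single 0 1))) ^ 2 :=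
    fun k => Finset.sum_congr rfl fun y _ => by ring
  rw [e12 2, e12 3, m02, m03, m12, m13]
  simp only [zero_pow two_ne_zero, Finset.sum_const_zero, add_zero]
  rw [← Finset.sum_add_distrib, ← Finset.sum_add_distrib, ← Finset.sum_add_distrib, ← Finset.sum_add_distrib]
  exact Finset.sum_congr rfl fun y _ => by ring

/-- **The norm of the optimal test form**: for `g = G̃ = torusGreen`, `Σ_q (dψ)_q² = 2 n_p` with
`n_p = (−Δ₀−Δ₁)G̃(0)` (Poisson equation + translation invariance). [folklore] -/
theorem sum_sq_rplaqCharge_testForm_torusGreen :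
    ∑ q : Plaquette 4 L, rplaqCharge (testForm (torusGreen (d := 4) (L := L))) q.1 q.2.1.1 q.2.1.2 ^ 2 =
      2 * ((2 * torusGreen (0 : Site 4 L) - torusGreen ((0 : Site 4 L) + Pi.single 0 1) -
            torusGreen ((0 : Site 4 L) - Pi.single 0 1)) +
          (2 * torusGreen (0 : Site 4 L) - torusGreen ((0 : Site 4 L) + Pi.single 1 1) -
            torusGreen ((0 : Site 4 L) - Pi.single 1 1))) := by
  rw [sum_sq_rplaqCharge_testForm]
  simp_rw [sum_secondDiff_torusGreen]
  have hsplit : ∀ y : Site 4 L,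
      ((2 * torusGreen y - torusGreen (y + Pi.single 0 1) - torusGreen (y - Pi.single 0 1)) +
          (2 * torusGreen y - torusGreen (y + Pi.single 1 1) - torusGreen (y - Pi.single 1 1))) *
        (2 * ((if y = 0 then (1 : ℝ) else 0) - 1 / (L : ℝ) ^ 4)) =
      2 * (if y = 0 then
        ((2 * torusGreen y - torusGreen (y + Pi.single 0 1) - torusGreen (y - Pi.single 0 1)) +
          (2 * torusGreen y - torusGreen (y + Pi.single 1 1) - torusGreen (y - Pi.single 1 1))) else 0) -
      2 / (L : ℝ) ^ 4 * ((2 * torusGreen y - torusGreen (y + Pi.single 0 1) - torusGreen (y - Pi.single 0 1)) +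
          (2 * torusGreen y - torusGreen (y + Pi.single 1 1) - torusGreen (y - Pi.single 1 1))) := by
    intro y; split_ifs <;> ring
  simp_rw [hsplit]
  rw [Finset.sum_sub_distrib, ← Finset.mul_sum, ← Finset.mul_sum, Finset.sum_ite_eq' Finset.univ (0 : Site 4 L),
    if_pos (Finset.mem_univ _), Finset.sum_add_distrib, sum_secondDiff_torusGreen_eq_zero,
    sum_secondDiff_torusGreen_eq_zero]
  ring

/-- **The charge of the optimal test form on its own plaquette**: `n_p = (−Δ₀−Δ₁)G̃(0) = 1 − L⁻⁴`.
[folklore] -/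
theorem rplaqCharge_testForm_torusGreen_self :
    rplaqCharge (testForm (torusGreen (d := 4) (L := L))) (0 : Site 4 L) 0 1 = 1 - 1 / (L : ℝ) ^ 4 := by
  rw [rplaqCharge_testForm_zero_one, secondDiff_torusGreen_zero (by norm_num) 0,
    secondDiff_torusGreen_zero (by norm_num) 1]
  norm_num
  ring

/-! ### The optimal Bogoliubov bound on a torus and on limit states -/

/-- **Optimal Bogoliubov bound on a torus** (`d = 4`, any side, `β ≥ 0`):
`(1 − L⁻⁴)·⟨cos θ_{(0;0,1)}⟩ ≤ 2β⟨sin²θ_{(0;0,1)}⟩` whenever `⟨cos θ_p⟩ ≥ 0`. [folklore] -/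
theorem torusPlaqSinSq_ge_optimal {β : ℝ} (hβ : 0 ≤ β)
    (hm : 0 ≤ wilsonExpectation u1Rep β
      (fun U : GaugeConfig 4 L Circle => ((plaquetteHolonomy U (0 : Site 4 L) 0 1 : Circle) : ℂ).re)) :
    (1 - 1 / (L : ℝ) ^ 4) * wilsonExpectation u1Rep β
        (fun U : GaugeConfig 4 L Circle => ((plaquetteHolonomy U (0 : Site 4 L) 0 1 : Circle) : ℂ).re) ≤
      2 * (β * wilsonExpectation u1Rep β
        (fun U : GaugeConfig 4 L Circle => ((plaquetteHolonomy U (0 : Site 4 L) 0 1 : Circle) : ℂ).im ^ 2)) := by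
  set m := wilsonExpectation u1Rep β
    (fun U : GaugeConfig 4 L Circle => ((plaquetteHolonomy U (0 : Site 4 L) 0 1 : Circle) : ℂ).re) with hmdef
  set S := wilsonExpectation u1Rep β
    (fun U : GaugeConfig 4 L Circle => ((plaquetteHolonomy U (0 : Site 4 L) 0 1 : Circle) : ℂ).im ^ 2) with hSdef
  set a : ℝ := 1 - 1 / (L : ℝ) ^ 4 with ha
  have h := sq_rplaqCharge_mul_le_sum_sq (testForm (torusGreen (d := 4) (L := L))) β (0 : Site 4 L)
    (show (0 : Fin 4) ≠ 1 by decide)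
  rw [rplaqCharge_testForm_torusGreen_self, sum_sq_rplaqCharge_testForm_torusGreen,
    ← rplaqCharge_testForm_zero_one, rplaqCharge_testForm_torusGreen_self, ← ha, ← hmdef, ← hSdef] at h
  -- h : a² m² ≤ β S (2a m)
  have ha0 : 0 ≤ a := by
    rw [ha, sub_nonneg]
    have hL1 : (1 : ℝ) ≤ (L : ℝ) ^ 4 := by
      have : (1 : ℝ) ≤ L := by exact_mod_cast Nat.one_le_iff_ne_zero.2 (NeZero.ne L)
      exact one_le_pow₀ this
    exact div_le_one_of_le₀ hL1 (by positivity)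
  have hS : 0 ≤ S := by
    rw [hSdef]; simp only [wilsonExpectation]; exact integral_nonneg fun U => sq_nonneg _
  by_cases ham : a * m = 0
  · have : a * m = 0 := ham
    calc a * m = 0 := this
      _ ≤ 2 * (β * S) := by positivity
  · have hpos : 0 < a * m := lt_of_le_of_ne (mul_nonneg ha0 hm) (Ne.symm ham)
    nlinarith [h, hpos]

/-- **Torus form, uniform in the volume**: for every `ε > 0` there is `β₁` such that for every `β > β₁`,
`2β⟨sin²θ_{(0;0,1)}⟩_{Λ_{M+1},β} ≥ 1 − ε` for all large `M`. [folklore] -/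
theorem torusPlaqSinSq_eventually_ge_optimal :
    ∀ ε : ℝ, 0 < ε → ∃ β₁ : ℝ, ∀ β : ℝ, β₁ < β → ∀ᶠ M : ℕ in atTop,
      1 - ε ≤ 2 * β * wilsonExpectation (L := M + 1) u1Rep β
        (toTorusObservable (M + 1) (fun U : LGConfig 4 Circle => u1PlaqIm 0 0 1 U * u1PlaqIm 0 0 1 U)) := by
  intro ε hε
  have hsp := SoloBlind.weakCoupling_singlePlaquette (d := 4) u1Rep (by norm_num) le_rfl
    isUnitaryModel_u1Rep 1 one_pos
  have hβ := hsp.and (eventually_ge_atTop (max 2 (5 / ε)))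
  obtain ⟨β₁, hβ₁⟩ := Filter.eventually_atTop.1 hβ
  refine ⟨β₁, fun β hb => ?_⟩
  obtain ⟨hL, hβε⟩ := hβ₁ β hb.le
  have hb0 : 2 ≤ β := le_trans (le_max_left _ _) hβε
  have hβε' : 5 / ε ≤ β := le_trans (le_max_right _ _) hβε
  -- volume threshold: `1/(M+1)^4 ≤ ε/2`
  obtain ⟨M₀, hM₀⟩ : ∃ M₀ : ℕ, 2 / ε ≤ (M₀ : ℝ) := exists_nat_ge (2 / ε)
  filter_upwards [hL, eventually_ge_atTop M₀] with M hM hMM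
  have hβpos : 0 < β := by linarith
  -- the mean cosine
  set m : ℝ := wilsonExpectation (L := M + 1) u1Rep β
    (fun U : GaugeConfig 4 (M + 1) Circle => ((plaquetteHolonomy U 0 0 1 : Circle) : ℂ).re) with hm
  have h := (abs_le.1 (hM (0 : Site 4 (M + 1)) 0 1 (by decide))).2
  have hcost : wilsonExpectation (L := M + 1) u1Rep β (SoloBlind.plaquetteCost u1Rep (0 : Site 4 (M + 1)) 0 1) =
      1 - m := by
    haveI := isProbabilityMeasure_wilsonMeasure (d := 4) (L := M + 1) (G := Circle) u1Rep continuous_u1Rep β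
    simp only [hm, wilsonExpectation, SoloBlind.plaquetteCost, trace_u1Rep_re, Nat.cast_one]
    rw [integral_sub (integrable_const _) (integrable_wilson_of_continuous β (continuous_plaquette_re 0 0 1)),
      integral_const, probReal_univ, one_smul]
  rw [hcost] at h
  norm_num at h
  have hm_ge : 1 - 5 / (4 * β) ≤ m := by
    have h54 : β * (1 - m) ≤ 5 / 4 := by linarith
    rw [sub_le_comm, le_div_iff₀ (by positivity)]
    linarith
  have hm0 : 0 ≤ m := by
    have : 5 / (4 * β) ≤ 1 := by rw [div_le_one (by positivity)]; linarith
    linarith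
  -- the torus observable is `sin² θ_{(0;0,1)}`
  have hobs : wilsonExpectation (L := M + 1) u1Rep β
      (toTorusObservable (M + 1) (fun U : LGConfig 4 Circle => u1PlaqIm 0 0 1 U * u1PlaqIm 0 0 1 U)) =
      wilsonExpectation (L := M + 1) u1Rep β
        (fun U : GaugeConfig 4 (M + 1) Circle => ((plaquetteHolonomy U 0 0 1 : Circle) : ℂ).im ^ 2) := by
    simp only [wilsonExpectation, toTorusObservable_apply, u1PlaqIm, plaquette_torusLift,
      Literature.MathematicalPhysics.QuantumFieldTheory.torusProj_zero, sq]
  rw [hobs]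
  have hopt := torusPlaqSinSq_ge_optimal (L := M + 1) hβpos.le (by rw [← hm]; exact hm0)
  rw [← hm] at hopt
  -- `a = 1 − 1/(M+1)^4 ≥ 1 − ε/2` and `m ≥ 1 − 5/(4β) ≥ 1 − ε/4`
  have hvol : 1 / ((M + 1 : ℕ) : ℝ) ^ 4 ≤ ε / 2 := by
    have hM1 : (2 / ε) ≤ ((M + 1 : ℕ) : ℝ) := by
      have : (M₀ : ℝ) ≤ ((M + 1 : ℕ) : ℝ) := by exact_mod_cast Nat.le_succ_of_le hMM
      linarith
    have hM1' : (2 / ε) ≤ ((M + 1 : ℕ) : ℝ) ^ 4 := by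
      have h1 : (1 : ℝ) ≤ ((M + 1 : ℕ) : ℝ) := by exact_mod_cast Nat.succ_le_succ (Nat.zero_le M)
      calc (2 / ε) ≤ ((M + 1 : ℕ) : ℝ) := hM1
        _ = ((M + 1 : ℕ) : ℝ) ^ 1 := (pow_one _).symm
        _ ≤ ((M + 1 : ℕ) : ℝ) ^ 4 := pow_le_pow_right₀ h1 (by norm_num)
    rw [div_le_iff₀ (by positivity)]
    have := (div_le_iff₀ hε).1 hM1'
    linarith
  have hcoup : 5 / (4 * β) ≤ ε / 4 := by
    rw [div_le_iff₀ (by positivity)]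
    have := (div_le_iff₀ hε).1 hβε'
    nlinarith
  set a : ℝ := 1 - 1 / ((M + 1 : ℕ) : ℝ) ^ 4 with ha
  have ha1 : 1 - ε / 2 ≤ a := by linarith
  have hm1 : 1 - ε / 4 ≤ m := by linarith
  have hm_le : m ≤ 1 := by
    haveI := isProbabilityMeasure_wilsonMeasure (d := 4) (L := M + 1) (G := Circle) u1Rep continuous_u1Rep β
    rw [hm]; simp only [wilsonExpectation]
    calc ∫ U, ((plaquetteHolonomy U (0 : Site 4 (M + 1)) 0 1 : Circle) : ℂ).re ∂wilsonMeasure u1Rep β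
        ≤ ∫ _U, (1 : ℝ) ∂wilsonMeasure u1Rep β :=
          integral_mono (integrable_wilson_of_continuous β (continuous_plaquette_re 0 0 1))
            (integrable_const _) fun U => (Complex.re_le_norm _).trans (le_of_eq (Circle.norm_coe _))
      _ = 1 := by simp
  -- `a m ≥ (1 − ε/2)(1 − ε/4) ≥ 1 − ε` when both factors are ≥ 0; handle small/large ε
  by_cases hε2 : ε ≤ 2
  · have ha0 : 0 ≤ 1 - ε / 2 := by linarith
    have hprod : (1 - ε / 2) * (1 - ε / 4) ≤ a * m :=
      mul_le_mul ha1 hm1 (by linarith) (le_trans ha0 ha1)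
    nlinarith [hprod, hopt, hε]
  · -- `ε > 2`: the bound `1 − ε < 0 ≤ 2βS` is trivial
    have hS : 0 ≤ wilsonExpectation (L := M + 1) u1Rep β
        (fun U : GaugeConfig 4 (M + 1) Circle => ((plaquetteHolonomy U 0 0 1 : Circle) : ℂ).im ^ 2) := by
      simp only [wilsonExpectation]; exact integral_nonneg fun U => sq_nonneg _
    nlinarith [hS, hβpos]

variable {β : ℝ} {μ : Measure (LGConfig 4 Circle)}

/-- **The lower half of the crux `WilsonU1PlaquetteSecondMomentD4`, parity-free**: for every `ε > 0`
there is `β₁` such that every infinite-volume torus limit state `μ` of Wilson `U(1)₄` at `β > β₁`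
satisfies `2β·⟨sin²θ_{(0;0,1)}⟩_μ ≥ 1 − ε`, i.e. `1 − ε ≤ 2β · U1Helicity.plaqCorr μ 0 0 1`. [folklore] -/
theorem wilsonU1PlaquetteSecondMoment_lower :
    ∀ ε : ℝ, 0 < ε → ∃ β₁ : ℝ, ∀ β : ℝ, β₁ < β →
      ∀ μ ∈ infiniteVolumeLimitPoints (d := 4) u1Rep β, 1 - ε ≤ 2 * β * plaqCorr μ 0 0 1 := by
  intro ε hε
  obtain ⟨β₁, hβ₁⟩ := torusPlaqSinSq_eventually_ge_optimal ε hε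
  refine ⟨β₁, fun β hb μ hμ => ?_⟩
  obtain ⟨φ, hφ, hlim⟩ := hμ
  have ht := (tendsto_torusPlaqSinSq hlim).const_mul (2 * β)
  refine ge_of_tendsto ht ?_
  exact hφ.tendsto_atTop.eventually (hβ₁ β hb)

end Summit.QuantumFields.YangMills.Theorems.U1DipoleHelicity
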